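import Summits.QuantumFields.YangMills.Theorems.AlphaInputsT3ACv3AdaptedClassX
import HarnessLib

/-!
# `AlphaInputsT3ACv3AdaptedSelX` — STRATEGY B for 2′, SEAM-BLIND RE-CUT PART X2: the MEASURABLE ARGMIN SELECTOR of the Wilson action over the **SEAM-BLIND** adapted class
# `𝒞_X(k, h, W)` (`AlphaInputsT3ACv3AdaptedClassX`), minimisers by compactness, and MEMBERSHIP ⇒ THE ROWS — lane `pub-balaban3d`, seat alpha-2 (g4)

CONTENTS.  g3's `…AdaptedSelR` VERBATIM with the W-independent core `localSmallT3X ∩ (reg68LocalSet ∩ large67Set)` (closed for `k ≤ K` at EVERY history — `isClosed_adaptedCoreX`):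
§1 ★ `AlphaInputsT3AC.exists_selector_adaptedClassT3X` — a measurable `f : SU(2)^{bonds_k} → SU(2)^{bonds_0}` with `f W ∈ argmin_{𝒞_X(k,h,W)} A` wherever a minimiser exists (`1`
elsewhere), and a minimiser EXISTS whenever `𝒞_X(k,h,W) ≠ ∅`; §2 membership ⇒ rows (`h68`, `hLF67`, r2, r3).
HONEST FRAMING.  Kinematics∕measurable selection only; nothing of [B10]∕[7]∕[4]'s estimates is asserted; the selected configuration is NOT claimed to be print's (42)-minimiser;
the class's non-emptiness is displayed elsewhere ((D6X), sibling `…DataSchemaX`), not proved.  Count-neutral helper toward R3 2′ (items 19935∕19936); nothing about d = 4, the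
continuum, or a mass gap.

References: T. Bałaban, Commun. Math. Phys. 102 (1985) 255–275 [Balaban1985UV3] ((42) p.266, (67)–(68) p.273); CMP 102 (1985) 277–309 [Balaban1985Variational]
(Thm 1 (8) p.279); C. D. Aliprantis, K. C. Border, Infinite Dimensional Analysis (2006) Thm 18.19 [AliprantisBorder2006].
-/

set_option autoImplicit false

noncomputable section

namespace Summit.QuantumFields.YangMills.Theorems

open MeasureTheory Set Topology TopologicalSpace
open scoped Matrix Matrix.Norms.L2Operator
open Literature.MeasureTheory.RandomSets
open Literature.MathematicalPhysics.QuantumFieldTheory.Balaban1983to89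
open Literature.MathematicalPhysics.QuantumFieldTheory.Balaban1983to89.B10 (pFun)
open Literature.MathematicalPhysics.QuantumFieldTheory.Balaban1983to89.T3ContinuumYM3Torus
open Literature.MathematicalPhysics.QuantumFieldTheory.Balaban1983to89.T3UnitLawDensityEML (ℰp)
open Literature.MathematicalPhysics.QuantumFieldTheory.Balaban1983to89.T3UnitScaleTilt (θBal)
open Literature.MathematicalPhysics.QuantumFieldTheory.Balaban1983to89.B10Eq38TorusDomains (plaqsIn)
open Literature.MathematicalPhysics.QuantumFieldTheory.Balaban1983to89.B10Eq42TorusConstraint (bondsIn lam42)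
open Literature.MathematicalPhysics.QuantumFieldTheory.Balaban1985CMP102.Setting
open Summit.QuantumFields.Balaban3D.Carriers
open Summit.QuantumFields.Balaban3D.Proofs.Primitives (AlphaConsts)
open Summit.QuantumFields.Balaban3D.Proofs.LiftBridge (liftCfg)
open Summit.QuantumFields.Balaban3D.Proofs.Run3SmallFactors (codeZ)
open Summit.QuantumFields.YangMills.Theorems.BalabanUVNodesN08AlphaGroupTopology
open B7Prop1Explicit (hol plaqWord)
open B7Prop1Local (pdevOn loK plaqHiK)
open B7Prop2Explicit (avgIter)

/-! ## §1 Minimisers and the measurable argmin selector over `𝒞_X(k, h, W)` -/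

section T3

variable {F : T3Family} {𝔠 : AlphaConsts F.L (suGroupModel 2).N} {γ : ℝ} {hγ : 0 < γ} {hγ1 : γ ≤ (min 𝔠.gamma0 1) ^ 2} {K : ℕ}

open Classical in
/-- **★ MINIMISERS AND A MEASURABLE ARGMIN SELECTOR FOR THE SEAM-BLIND ADAPTED CLASS** (`k ≤ K`, any history): (i) a measurable
`f : SU(2)^{bonds_k} → SU(2)^{bonds_0}` with `f W ∈ argmin_{𝒞_X(k,h,W)} A` (Wilson action) wherever a minimiser exists and `f W = 1` elsewhere; (ii) a minimiser
EXISTS as soon as `𝒞_X(k, h, W) ≠ ∅`.  g0's closed-class selection with `C` = the W-independent core, `g Ũ = ((blockAvg ℰp)^k Ũ patched to 1 off the level-k cone, Ũ)`,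
`π W = (W, 1)` and the closed relation «`W` charged ⇒ top constraint on the bonds of `Ω_k(h)` ∧ r3».
[cite: Balaban1985Variational, Thm 1 (8) p.279 (existence half by compactness; measurable-selection reading)] -/
theorem AlphaInputsT3AC.exists_selector_adaptedClassT3X {k : ℕ} (hk : k ≤ K) (h : Hist (F.P K) k) :
    (∃ f : GaugeField (F.P K) k (Matrix.specialUnitaryGroup (Fin 2) ℂ) → GaugeField (F.P K) 0 (Matrix.specialUnitaryGroup (Fin 2) ℂ),
      Measurable f ∧
      (∀ W, (∃ U ∈ AlphaInputsT3AC.adaptedClassT3X F 𝔠 γ hγ hγ1 K k h W,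
          IsMinOn (fun U : GaugeField (F.P K) 0 (Matrix.specialUnitaryGroup (Fin 2) ℂ) => wilsonAction4 U)
            (AlphaInputsT3AC.adaptedClassT3X F 𝔠 γ hγ hγ1 K k h W) U) →
        f W ∈ AlphaInputsT3AC.adaptedClassT3X F 𝔠 γ hγ hγ1 K k h W ∧
          IsMinOn (fun U : GaugeField (F.P K) 0 (Matrix.specialUnitaryGroup (Fin 2) ℂ) => wilsonAction4 U)
            (AlphaInputsT3AC.adaptedClassT3X F 𝔠 γ hγ hγ1 K k h W) (f W)) ∧
      (∀ W, ¬ (∃ U ∈ AlphaInputsT3AC.adaptedClassT3X F 𝔠 γ hγ hγ1 K k h W,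
          IsMinOn (fun U : GaugeField (F.P K) 0 (Matrix.specialUnitaryGroup (Fin 2) ℂ) => wilsonAction4 U)
            (AlphaInputsT3AC.adaptedClassT3X F 𝔠 γ hγ hγ1 K k h W) U) → f W = 1)) ∧
    (∀ W, (AlphaInputsT3AC.adaptedClassT3X F 𝔠 γ hγ hγ1 K k h W).Nonempty →
      ∃ U ∈ AlphaInputsT3AC.adaptedClassT3X F 𝔠 γ hγ hγ1 K k h W,
        IsMinOn (fun U : GaugeField (F.P K) 0 (Matrix.specialUnitaryGroup (Fin 2) ℂ) => wilsonAction4 U)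
          (AlphaInputsT3AC.adaptedClassT3X F 𝔠 γ hγ hγ1 K k h W) U) := by
  haveI : CompactSpace (GaugeField (F.P K) 0 (Matrix.specialUnitaryGroup (Fin 2) ℂ)) :=
    inferInstanceAs (CompactSpace (PBond (F.P K) 0 → Matrix.specialUnitaryGroup (Fin 2) ℂ))
  haveI : PolishSpace (Matrix.specialUnitaryGroup (Fin 2) ℂ) := polishSpace_rho (suGroupModel 2)
  haveI : PolishSpace (GaugeField (F.P K) 0 (Matrix.specialUnitaryGroup (Fin 2) ℂ)) :=
    inferInstanceAs (PolishSpace (PBond (F.P K) 0 → Matrix.specialUnitaryGroup (Fin 2) ℂ))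
  haveI : SecondCountableTopology (GaugeField (F.P K) 0 (Matrix.specialUnitaryGroup (Fin 2) ℂ)) :=
    inferInstanceAs (SecondCountableTopology (PBond (F.P K) 0 → Matrix.specialUnitaryGroup (Fin 2) ℂ))
  haveI : BorelSpace (GaugeField (F.P K) 0 (Matrix.specialUnitaryGroup (Fin 2) ℂ)) :=
    inferInstanceAs (BorelSpace (PBond (F.P K) 0 → Matrix.specialUnitaryGroup (Fin 2) ℂ))
  haveI : SecondCountableTopology (GaugeField (F.P K) k (Matrix.specialUnitaryGroup (Fin 2) ℂ)) :=
    inferInstanceAs (SecondCountableTopology (PBond (F.P K) k → Matrix.specialUnitaryGroup (Fin 2) ℂ))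
  haveI : BorelSpace (GaugeField (F.P K) k (Matrix.specialUnitaryGroup (Fin 2) ℂ)) :=
    inferInstanceAs (BorelSpace (PBond (F.P K) k → Matrix.specialUnitaryGroup (Fin 2) ℂ))
  -- the data of the closed-class selection
  let C : Set (GaugeField (F.P K) 0 (Matrix.specialUnitaryGroup (Fin 2) ℂ)) :=
    AlphaInputsT3AC.localSmallT3X F 𝔠 γ hγ hγ1 K k h ∩
      (AlphaInputsT3AC.reg68LocalSet F 𝔠 γ hγ hγ1 K k h ∩ AlphaInputsT3AC.large67Set F 𝔠 γ hγ hγ1 K k h)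
  have hC : IsClosed C := AlphaInputsT3AC.isClosed_adaptedCoreX (𝔠 := 𝔠) (hγ := hγ) (hγ1 := hγ1) (h := h) hk
  -- the level-`k` average of record PATCHED to `1` off the level-`k` cone (continuous on the core)
  let patch : GaugeField (F.P K) 0 (Matrix.specialUnitaryGroup (Fin 2) ℂ) → GaugeField (F.P K) k (Matrix.specialUnitaryGroup (Fin 2) ℂ) :=
    fun U b => if b ∈ AlphaInputsT3AC.readBondsT3 F 𝔠 γ hγ hγ1 K k h k then
      Averaging.iter (fun i => BlockAveraging.blockAvg (P := F.P K) (j := i) ℰp) k U b else 1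
  have hpatch : ContinuousOn patch C := by
    refine continuousOn_pi.2 fun b => ?_
    by_cases hb : b ∈ AlphaInputsT3AC.readBondsT3 F 𝔠 γ hγ hγ1 K k h k
    · simp only [patch, if_pos hb]
      exact (AlphaInputsT3AC.continuousOn_iter_readBondX (𝔠 := 𝔠) (hγ1 := hγ1) hk h le_rfl hb).mono fun U hU => hU.1
    · simp only [patch, if_neg hb]
      exact continuousOn_const
  let g : GaugeField (F.P K) 0 (Matrix.specialUnitaryGroup (Fin 2) ℂ) →
      GaugeField (F.P K) k (Matrix.specialUnitaryGroup (Fin 2) ℂ) × GaugeField (F.P K) 0 (Matrix.specialUnitaryGroup (Fin 2) ℂ) :=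
    fun U => (patch U, U)
  have hg : ContinuousOn g C := hpatch.prodMk continuousOn_id
  let π : GaugeField (F.P K) k (Matrix.specialUnitaryGroup (Fin 2) ℂ) →
      GaugeField (F.P K) k (Matrix.specialUnitaryGroup (Fin 2) ℂ) × GaugeField (F.P K) 0 (Matrix.specialUnitaryGroup (Fin 2) ℂ) :=
    fun W => (W, 1)
  have hπ : Measurable π := measurable_id.prodMk measurable_const
  let Sm : Set (GaugeField (F.P K) k (Matrix.specialUnitaryGroup (Fin 2) ℂ)) :=
    {W | ChargedT3 F γ 𝔠.b₀ 𝔠.p₀ (avgWindowFactor F.L) K 𝔠.lane.carrier.M₁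
      (rcolOf (T3Scales F γ hγ (hγ1.trans (sq_min_one_le _ 𝔠.gamma0_pos)) K) 𝔠.lane.carrier) k h W}
  let Bk : Set (PBond (F.P K) k) := bondsIn k (Omega 𝔠.lane.carrier.M₁
      (rcolOf (T3Scales F γ hγ (hγ1.trans (sq_min_one_le _ 𝔠.gamma0_pos)) K) 𝔠.lane.carrier) k h k)
  let D : Set (GaugeField (F.P K) 0 (Matrix.specialUnitaryGroup (Fin 2) ℂ)) :=
    AlphaInputsT3AC.localSmallT3X F 𝔠 γ hγ hγ1 K k h ∩ AlphaInputsT3AC.reg68LevelsSet F 𝔠 γ hγ hγ1 K k h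
  let R : Set ((GaugeField (F.P K) k (Matrix.specialUnitaryGroup (Fin 2) ℂ) × GaugeField (F.P K) 0 (Matrix.specialUnitaryGroup (Fin 2) ℂ)) ×
      (GaugeField (F.P K) k (Matrix.specialUnitaryGroup (Fin 2) ℂ) × GaugeField (F.P K) 0 (Matrix.specialUnitaryGroup (Fin 2) ℂ))) :=
    {p | p.2.1 ∈ Sm → (∀ b ∈ Bk, p.1.1 b = p.2.1 b) ∧ p.1.2 ∈ D}
  have hcoordk : ∀ b : PBond (F.P K) k, Continuous fun V : GaugeField (F.P K) k (Matrix.specialUnitaryGroup (Fin 2) ℂ) => V b :=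
    fun b => continuous_apply b
  have hR : IsClosed R := by
    have hset : R = {p | p.2.1 ∈ Sm}ᶜ ∪ ((⋂ b ∈ Bk, {p | p.1.1 b = p.2.1 b}) ∩ {p | p.1.2 ∈ D}) := by
      ext p
      simp only [R, mem_setOf_eq, mem_union, mem_compl_iff, mem_inter_iff, mem_iInter]
      by_cases hp : p.2.1 ∈ Sm
      · simp only [hp, forall_true_left, not_true_eq_false, false_or]
      · simp only [hp, IsEmpty.forall_iff, not_false_eq_true, true_or]
    rw [hset]
    refine IsClosed.union ?_ (IsClosed.inter (isClosed_biInter fun b _ => ?_) ?_)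
    · exact ((AlphaInputsT3AC.isOpen_chargedT3 (𝔠 := 𝔠) (hγ1 := hγ1) k h).preimage (continuous_fst.comp continuous_snd)).isClosed_compl
    · exact isClosed_eq ((hcoordk b).comp (continuous_fst.comp continuous_fst)) ((hcoordk b).comp (continuous_fst.comp continuous_snd))
    · exact (AlphaInputsT3AC.isClosed_localSmallT3X_inter_reg68LevelsSet (𝔠 := 𝔠) (hγ1 := hγ1) hk h).preimage (continuous_snd.comp continuous_fst)
  -- the bonds of `Ω_k(h)` are read bonds, so the patch does not touch them
  have hBk : ∀ b ∈ Bk, ∀ U, patch U b = Averaging.iter (fun i => BlockAveraging.blockAvg (P := F.P K) (j := i) ℰp) k U b :=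
    fun b hb U => if_pos (AlphaInputsT3AC.mem_readBondsT3_top (𝔠 := 𝔠) (hγ1 := hγ1) hb)
  -- the admissible sets of the selection ARE the seam-blind adapted classes
  have hadm : ∀ W, {U | U ∈ C ∧ (g U, π W) ∈ R} = AlphaInputsT3AC.adaptedClassT3X F 𝔠 γ hγ hγ1 K k h W := by
    intro W
    ext U
    simp only [C, g, π, R, Sm, Bk, D, AlphaInputsT3AC.adaptedClassT3X, AlphaInputsT3AC.top42Set, mem_setOf_eq, mem_inter_iff]
    constructor
    · rintro ⟨⟨hN, hReg, hL⟩, hrel⟩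
      refine ⟨hN, hReg, hL, fun hc => ⟨fun b hb => ?_, (hrel hc).2.2⟩⟩
      rw [← hBk b hb U]; exact (hrel hc).1 b hb
    · rintro ⟨hN, hReg, hL, hrel⟩
      refine ⟨⟨hN, hReg, hL⟩, fun hc => ⟨fun b hb => ?_, hN, (hrel hc).2⟩⟩
      rw [hBk b hb U]; exact (hrel hc).1 b hb
  obtain ⟨⟨f, hfm, hfin, hfout⟩, hex⟩ := exists_measurable_argmin_closedClass hπ hC hg hR AlphaInputsT3AC.continuous_wilsonAction4_su2 1
  simp only [hadm] at hfin hfout hex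
  exact ⟨⟨f, hfm, hfin, hfout⟩, hex⟩

/-! ## §2 Membership ⇒ the rows' texts -/

/-- **MEMBERSHIP ⇒ ROW `h68`**: a member of `𝒞_X(k, h, W)`, `k ≤ K`, satisfies the v3 row `h68`'s text — DIRECTLY from the read-local (68) conjunct (`½C68·… < C68·…`).
[cite: Balaban1985UV3, (68) p.273] -/
theorem AlphaInputsT3AC.h68_of_mem_adaptedClassT3X {k : ℕ} (hk : k ≤ K) {h : Hist (F.P K) k}
    {W : GaugeField (F.P K) k (Matrix.specialUnitaryGroup (Fin 2) ℂ)} {U : GaugeField (F.P K) 0 (Matrix.specialUnitaryGroup (Fin 2) ℂ)}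
    (hU : U ∈ AlphaInputsT3AC.adaptedClassT3X F 𝔠 γ hγ hγ1 K k h W) :
    ∀ e ∈ Hist.disc h,
      pdevOn (loK F.L e.1 (codeZ e)) (plaqHiK F.L e.1 (codeZ e) e.2.2.1 e.2.2.2)
          (liftCfg (S := T3Scales F γ hγ (hγ1.trans (sq_min_one_le _ 𝔠.gamma0_pos)) K) (suGroupModel 2) U) <
        𝔠.C68 * ((T3Scales F γ hγ (hγ1.trans (sq_min_one_le _ 𝔠.gamma0_pos)) K).gk e.1 *
          pFun 𝔠.lane.carrier.b₀ 𝔠.lane.carrier.p₀ ((T3Scales F γ hγ (hγ1.trans (sq_min_one_le _ 𝔠.gamma0_pos)) K).gk e.1)) *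
          (((F.L : ℝ) ^ e.1)⁻¹) ^ 2 :=
  AlphaInputsT3AC.h68_of_mem_reg68LocalSet (𝔠 := 𝔠) (hγ1 := hγ1) hk hU.2.1

/-- **MEMBERSHIP ⇒ ROW `hLF67`**: a member of `𝒞_X(k, h, W)` satisfies the v3 row `hLF67`'s text (it is the (67)-largeness conjunct). [cite: Balaban1985UV3, (67) p.273] -/
theorem AlphaInputsT3AC.hLF67_of_mem_adaptedClassT3X {k : ℕ} {h : Hist (F.P K) k}
    {W : GaugeField (F.P K) k (Matrix.specialUnitaryGroup (Fin 2) ℂ)} {U : GaugeField (F.P K) 0 (Matrix.specialUnitaryGroup (Fin 2) ℂ)}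
    (hU : U ∈ AlphaInputsT3AC.adaptedClassT3X F 𝔠 γ hγ hγ1 K k h W) :
    ∀ e ∈ Hist.disc h,
      (T3Scales F γ hγ (hγ1.trans (sq_min_one_le _ 𝔠.gamma0_pos)) K).gk e.1 *
          pFun 𝔠.lane.carrier.b₀ 𝔠.lane.carrier.p₀ ((T3Scales F γ hγ (hγ1.trans (sq_min_one_le _ 𝔠.gamma0_pos)) K).gk e.1) ≤
        ‖((hol (avgIter F.L (liftCfg (S := T3Scales F γ hγ (hγ1.trans (sq_min_one_le _ 𝔠.gamma0_pos)) K) (suGroupModel 2) U) e.1)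
            (codeZ e) (plaqWord e.2.2.1 e.2.2.2) : (Matrix (Fin (suGroupModel 2).N) (Fin (suGroupModel 2).N) ℂ)ˣ) :
            Matrix (Fin (suGroupModel 2).N) (Fin (suGroupModel 2).N) ℂ) - 1‖ :=
  hU.2.2.1

/-- **MEMBERSHIP ⇒ ROW r2** for a charged datum: the top constraint (42) on the bonds of `Ω_k(h)`. [cite: Balaban1985UV3, (42) p.266] -/
theorem AlphaInputsT3AC.constraint42_of_mem_adaptedClassT3X {k : ℕ} {h : Hist (F.P K) k}
    {W : GaugeField (F.P K) k (Matrix.specialUnitaryGroup (Fin 2) ℂ)} {U : GaugeField (F.P K) 0 (Matrix.specialUnitaryGroup (Fin 2) ℂ)}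
    (hU : U ∈ AlphaInputsT3AC.adaptedClassT3X F 𝔠 γ hγ hγ1 K k h W)
    (hc : ChargedT3 F γ 𝔠.b₀ 𝔠.p₀ (avgWindowFactor F.L) K 𝔠.lane.carrier.M₁
      (rcolOf (T3Scales F γ hγ (hγ1.trans (sq_min_one_le _ 𝔠.gamma0_pos)) K) 𝔠.lane.carrier) k h W)
    (b : PBond (F.P K) k)
    (hb : b ∈ bondsIn k (Omega 𝔠.lane.carrier.M₁
      (rcolOf (T3Scales F γ hγ (hγ1.trans (sq_min_one_le _ 𝔠.gamma0_pos)) K) 𝔠.lane.carrier) k h k)) :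
    Averaging.iter (fun i => BlockAveraging.blockAvg (P := F.P K) (j := i) ℰp) k U b = W b :=
  (hU.2.2.2 hc).1 b hb

/-- **MEMBERSHIP ⇒ ROW r3** for a charged datum: the multi-level regularity (68). [cite: Balaban1985UV3, (68) p.273] -/
theorem AlphaInputsT3AC.regularity68Levels_of_mem_adaptedClassT3X {k : ℕ} {h : Hist (F.P K) k}
    {W : GaugeField (F.P K) k (Matrix.specialUnitaryGroup (Fin 2) ℂ)} {U : GaugeField (F.P K) 0 (Matrix.specialUnitaryGroup (Fin 2) ℂ)}
    (hU : U ∈ AlphaInputsT3AC.adaptedClassT3X F 𝔠 γ hγ hγ1 K k h W)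
    (hc : ChargedT3 F γ 𝔠.b₀ 𝔠.p₀ (avgWindowFactor F.L) K 𝔠.lane.carrier.M₁
      (rcolOf (T3Scales F γ hγ (hγ1.trans (sq_min_one_le _ 𝔠.gamma0_pos)) K) 𝔠.lane.carrier) k h W)
    (i : ℕ) (hi : i ≤ k) (s : ℕ) (hs : s ≤ i) (q : Plaq (F.P K) s)
    (hq : q ∈ plaqsIn s (lam42 (Omega 𝔠.lane.carrier.M₁
      (rcolOf (T3Scales F γ hγ (hγ1.trans (sq_min_one_le _ 𝔠.gamma0_pos)) K) 𝔠.lane.carrier) k h) k i)) :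
    GaugeGroup.dist1 (GaugeField.plaqHol
        (Averaging.iter (fun l => BlockAveraging.blockAvg (P := F.P K) (j := l) ℰp) s U) q) ≤
      𝔠.C68 * θBal F.L γ 𝔠.b₀ 𝔠.p₀ (K - i) * (((F.L : ℝ) ^ (i - s))⁻¹) ^ 2 :=
  (hU.2.2.2 hc).2 i hi s hs q hq

end T3

end Summit.QuantumFields.YangMills.Theorems

end
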